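import Summits.Ventures.PercRepro.C025ProfileRankFourCert
import Summits.Ventures.PercRepro.C025ProfileCertBridge

/-!
# THE ROW (2,4) OF THE PROFILE INEQUALITY — the certificate `w24` (night-3 g9)

`proofs/NIGHT3-G9-TWO-FOUR-CERTIFICATE.md` §1: a closed-form local certificate for the row `(2,4)` of C-032,
`Σ_{B : ρ(B) = 2, ρ(E∖B) ≥ 4} C(ρ(E∖B),2)/6 ≤ #{S : ρ(S) = 4}`, verified exactly on every simple matroid of rank `≥ 5` of the
lab's data (§3 of the paper). With `p = ρ(E∖B)`, `r = ρ(E∖S)`, `j = min(2, |cl B ∖ B|)`, `e = |S ∖ B|`, `R = ρ(E)`, and for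
`e = 3`, `Y = S ∖ B`: `m = |Y ∩ cl B|` (the loops of `M/B` in `Y`), `par = [some pair of Y ∖ cl B is coplanar with B]`:
* (G) `e = 2`: `1/6` for every pair, and for a fat `B` with `j = 0`; fat `B` with `j ≥ 1`: `(C(p,2)/6)/C(r+2−j, 2)`;
* (P) `e = 3`, `m = 0`, `par`: on the window `p − 3 ≤ r ≤ p − 3 + j`: `1/(6(p−3))` (`j = 0`, `p = R`; `j = 2`), `1/(6(p−2))`
  (`j = 0`, `p < R`), `p/(6(p−2)(p−3))` (`j = 1`); plus `1/72` at `(j, p, r) = (0, 5, 3)`;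
* (L) `e = 3`, `|B| = 2`, `m = 1`: `j = 1`: `1/(3(p−2))` at `r = p−3`; `j = 2`: `(2p−3)/(6(p−2)(p−3))`, `(2p−3)/(9(p−2)(p−3))`,
  `1/(6(p−2))` at `r = p−3, p−2, p−1`;
* `0` otherwise (`p < 4`, `e ≥ 4`, the circuit shapes, fat sets with `m ≥ 1`).
This module: the rule (`w24`, the same cases as the lab's `rule24_W_verified.py`), `w24_nonneg`, the price
`price_two_four_eq` (`C(p+2,4)/C(p+2,2) = p(p−1)/12`), (Cap) on the INDEPENDENT rank-4 sets (`cap_w24_of_card_four`: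
six pairs at `1/6`), and the double count **`profileIneq_two_four_of_cert24`** / **`hallIneq_two_four_of_cert24`** from
C025ProfileCertBridge. What is NOT here: (Cap) for `|S| ≥ 5` and (Dem) — the paper's §4 plan.
-/

open scoped Matroid

namespace PercRepro

open Set Finset ThmH

section FourRule

variable {α : Type} [DecidableEq α] (M : Matroid α) [M.Finite]

/-- The points of `S ∖ B` on the line of `B` (the loops of `M／B` inside `S`). -/
noncomputable def mL (B S : Finset α) : ℕ := ((S \ B) ∩ clF M B).card

/-- `par(B,S)`: two points of `S ∖ B` off the line of `B` that are coplanar with `B` (a parallel pair of `M／B`). -/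
def parB (B S : Finset α) : Prop :=
  ∃ y ∈ (S \ B) \ clF M B, ∃ y' ∈ (S \ B) \ clF M B, y ≠ y' ∧
    M.eRk ((insert y (insert y' B) : Finset α) : Set α) = 3

open scoped Classical in
/-- **The certificate of the row `(2,4)`** (NIGHT3-G9-TWO-FOUR-CERTIFICATE.md §1), capacity-`1` normalisation. -/
noncomputable def w24 (B S : Finset α) : ℚ :=
  let p := crk M B
  let r := crk M S
  let j := jB M B
  let e := (S \ B).card
  let R := crk M (∅ : Finset α)
  let b := B.card
  if p < 4 then 0
  else if e = 2 then
    (if 3 ≤ b ∧ 1 ≤ j then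
      (if 2 ≤ r + 2 - j then ((p : ℚ) * ((p : ℚ) - 1) / 12) / (Nat.choose (r + 2 - j) 2 : ℚ) else 0)
     else 1 / 6)
  else if e = 3 then
    (if mL M B S = 0 ∧ parB M B S then
      (if p ≤ r + 3 ∧ r ≤ p - 3 + j then
        (if j = 0 then (if p < R then 1 / (6 * ((p : ℚ) - 2)) else 1 / (6 * ((p : ℚ) - 3)))
         else if j = 1 then (p : ℚ) / (6 * ((p : ℚ) - 2) * ((p : ℚ) - 3))
         else 1 / (6 * ((p : ℚ) - 3)))
       else if j = 0 ∧ r + 2 = p ∧ p = 5 then 1 / 72 else 0)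
     else if b = 2 ∧ mL M B S = 1 then
      (if j = 1 then (if r + 3 = p then 1 / (3 * ((p : ℚ) - 2)) else 0)
       else if j = 2 then
        (if r + 3 = p then (2 * (p : ℚ) - 3) / (6 * ((p : ℚ) - 2) * ((p : ℚ) - 3))
         else if r + 2 = p then (2 * (p : ℚ) - 3) / (9 * ((p : ℚ) - 2) * ((p : ℚ) - 3))
         else if r + 1 = p then 1 / (6 * ((p : ℚ) - 2)) else 0)
       else 0)
     else 0)
  else 0

variable {M}

/-- `w24 ≥ 0`: every nonzero branch is a quotient of nonnegative quantities (`p ≥ 4` there). -/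
theorem w24_nonneg (B S : Finset α) : 0 ≤ w24 M B S := by
  classical
  unfold w24
  simp only
  by_cases h1 : crk M B < 4
  · rw [if_pos h1]
  · have hp : (4 : ℚ) ≤ (crk M B : ℚ) := by exact_mod_cast (not_lt.1 h1)
    have h2 : (0 : ℚ) ≤ (crk M B : ℚ) - 2 := by linarith
    have h3 : (0 : ℚ) ≤ (crk M B : ℚ) - 3 := by linarith
    have h23 : (0 : ℚ) ≤ ((crk M B : ℚ) - 2) * ((crk M B : ℚ) - 3) := mul_nonneg h2 h3
    rw [if_neg h1]
    split_ifs <;> first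
      | (exact le_refl _)
      | (norm_num; done)
      | (apply div_nonneg <;> first | positivity | linarith)

/-- `C(p+2,4)/C(p+2,2) = p(p−1)/12`. -/
theorem choose_ratio_two_four (p : ℕ) :
    (Nat.choose (p + 2) 4 : ℚ) / (Nat.choose (p + 2) 2 : ℚ) = (p : ℚ) * ((p : ℚ) - 1) / 12 := by
  have hpos : (0 : ℚ) < Nat.choose (p + 2) 2 := by exact_mod_cast Nat.choose_pos (by omega)
  rw [div_eq_div_iff hpos.ne' (by norm_num : (12 : ℚ) ≠ 0)]
  rcases Nat.eq_zero_or_pos p with rfl | hp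
  · norm_num [Nat.choose]
  · have h3 := Nat.choose_succ_right_eq (p + 2) 2
    have h4 := Nat.choose_succ_right_eq (p + 2) 3
    rw [show p + 2 - 2 = p by omega] at h3
    rw [show p + 2 - 3 = p - 1 by omega] at h4
    have h3' : ((Nat.choose (p + 2) 3 * 3 : ℕ) : ℚ) = ((Nat.choose (p + 2) 2 * p : ℕ) : ℚ) := by rw [h3]
    have h4' : ((Nat.choose (p + 2) 4 * 4 : ℕ) : ℚ) = ((Nat.choose (p + 2) 3 * (p - 1) : ℕ) : ℚ) := by rw [h4]
    push_cast [Nat.cast_sub hp] at h3' h4'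
    linear_combination 3 * h4' + ((p : ℚ) - 1) * h3'

/-- The price at `(2, 4)` is `[4 ≤ ρ(E∖B)] · ρ(E∖B)(ρ(E∖B)−1)/12`. -/
theorem price_two_four_eq (B : Finset α) :
    Profile.price M 2 4 B = if 4 ≤ crk M B then (crk M B : ℚ) * ((crk M B : ℚ) - 1) / 12 else 0 := by
  have hfin : M.eRk ((gr M \ B : Finset α) : Set α) ≠ ⊤ := by
    rw [← lt_top_iff_ne_top]; exact (M.isRkFinite_set _).eRk_lt_top
  unfold Profile.price crk
  rw [← ENat.coe_toNat hfin, ENat.toNat_coe]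
  by_cases h : 4 ≤ (M.eRk ((gr M \ B : Finset α) : Set α)).toNat
  · rw [if_pos (by exact_mod_cast h), if_pos h, choose_ratio_two_four]
  · rw [if_neg (by exact_mod_cast h), if_neg h]

/-- A pair with two extra points pays `1/6` when active. -/
theorem w24_of_pair_of_sdiff_two {B S : Finset α} (hB2 : B.card = 2) (he : (S \ B).card = 2)
    (hp : 4 ≤ crk M B) : w24 M B S = 1 / 6 := by
  classical
  unfold w24
  simp only
  rw [if_neg (not_lt.2 hp), if_pos he, if_neg]
  omega

/-- A pair with two extra points pays at most `1/6`. -/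
theorem w24_le_sixth_of_pair {B S : Finset α} (hB2 : B.card = 2) (he : (S \ B).card = 2) :
    w24 M B S ≤ 1 / 6 := by
  by_cases hp : 4 ≤ crk M B
  · rw [w24_of_pair_of_sdiff_two hB2 he hp]
  · have h0 : w24 M B S = 0 := by
      classical
      unfold w24
      simp only
      rw [if_pos (not_le.1 hp)]
    rw [h0]; norm_num

/-- **(Cap) on the independent rank-4 sets**: a rank-4 set with four elements has exactly its six pairs as rank-2
subsets, each paying `≤ 1/6`. -/
theorem cap_w24_of_card_four {S : Finset α} (hS : S ∈ Shadow.levelSet M 4) (hS4 : S.card = 4) :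
    ∑ B ∈ (Profile.Rq M 2).filter (fun B => B ⊆ S), w24 M B S ≤ 1 := by
  classical
  rw [Profile.mem_levelSet] at hS
  have hSind : M.Indep (S : Set α) := by
    rw [Matroid.indep_iff_eRk_eq_encard_of_finite (Finset.finite_toSet S), hS.2,
      Set.encard_coe_eq_coe_finsetCard, hS4]
  have hsub : (Profile.Rq M 2).filter (fun B => B ⊆ S) ⊆ S.powersetCard 2 := by
    intro B hB
    rw [Finset.mem_filter, Profile.mem_Rq] at hB
    rw [Finset.mem_powersetCard]
    refine ⟨hB.2, ?_⟩
    have hBind : M.Indep (B : Set α) := hSind.subset (by exact_mod_cast hB.2)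
    have h2 := hBind.eRk_eq_encard
    rw [hB.1.2, Set.encard_coe_eq_coe_finsetCard] at h2
    exact_mod_cast h2.symm
  have hterm : ∀ B ∈ (Profile.Rq M 2).filter (fun B => B ⊆ S), w24 M B S ≤ 1 / 6 := by
    intro B hB
    have hB' := hsub hB
    rw [Finset.mem_powersetCard] at hB'
    apply w24_le_sixth_of_pair hB'.2
    rw [Finset.card_sdiff, Finset.inter_eq_left.2 hB'.1, hS4, hB'.2]
  calc ∑ B ∈ (Profile.Rq M 2).filter (fun B => B ⊆ S), w24 M B S
      ≤ ∑ _B ∈ (Profile.Rq M 2).filter (fun B => B ⊆ S), (1 / 6 : ℚ) := Finset.sum_le_sum hterm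
    _ = (((Profile.Rq M 2).filter (fun B => B ⊆ S)).card : ℚ) * (1 / 6) := by
        rw [Finset.sum_const, nsmul_eq_mul]
    _ ≤ ((S.powersetCard 2).card : ℚ) * (1 / 6) := by
        gcongr
    _ = 1 := by
        rw [Finset.card_powersetCard, hS4]
        norm_num [Nat.choose]

/-- **The double count with `w24`**: (Cap) ∧ (Dem) on `M` give `(Π_{2,4})` on `M`. -/
theorem profileIneq_two_four_of_cert24
    (hCap : ∀ S ∈ Shadow.levelSet M 4, ∑ B ∈ (Profile.Rq M 2).filter (fun B => B ⊆ S), w24 M B S ≤ 1)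
    (hDem : ∀ B ∈ Profile.Rq M 2,
      Profile.price M 2 4 B ≤ ∑ S ∈ (Shadow.levelSet M 4).filter (fun S => B ⊆ S), w24 M B S) :
    Profile.ProfileIneq M 2 4 :=
  profileIneq_of_cert 2 4 (w24 M) hCap hDem

/-- **The double count with `w24`, Hall form**: (Cap) ∧ (Dem) on `M` give `(H⁺_{2,4})` on `M`. -/
theorem hallIneq_two_four_of_cert24
    (hCap : ∀ S ∈ Shadow.levelSet M 4, ∑ B ∈ (Profile.Rq M 2).filter (fun B => B ⊆ S), w24 M B S ≤ 1)
    (hDem : ∀ B ∈ Profile.Rq M 2,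
      Profile.price M 2 4 B ≤ ∑ S ∈ (Shadow.levelSet M 4).filter (fun S => B ⊆ S), w24 M B S) :
    Profile.HallIneq M 2 4 :=
  hallIneq_of_cert 2 4 (w24 M) (fun B S => w24_nonneg B S) hCap hDem

end FourRule

end PercRepro
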